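import Literature.AnabelianGeometry.AbsoluteAnabelian.ArchimedeanHolFieldFunctorGeometricPSLCentralizer
import Mathlib.Analysis.Complex.UpperHalfPlane.ProperAction
import Mathlib.Topology.Algebra.ProperAction.Basic
import HarnessLib

/-!
# The normaliser of a cocompact Fuchsian group contains it with FINITE INDEX

S. Mochizuki, *Topics in absolute anabelian geometry III*, proof of Prop. 4.2 (i), kurims p. 106
(`paper:url-5493eb38cbb7`; bib key `MochizukiAbsTopIII2015`): the id-rigidity of `Loc_R(X)` «follows
immediately from the slimness assertion of Lemma 4.3» for the orbicurve `[X/Aut X]`.  At the uniformised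
model `X = ℍ/Γ̄` (abc-iut-L4-t14, `HolRS.isIdRigid_mapsTo_pslQuotient_of_centralizer`) the statement
carries the hypothesis `[(Γ̄.subgroupOf N_{PSL₂(ℝ)}(Γ̄)).FiniteIndex]` — finiteness of
`Aut(X) = N(Γ̄)/Γ̄` (campaign-L residual «J2 (i)»).  This PROOF-ONLY file (no definition, no named fact)
proves it for COCOMPACT `Γ̄` WITHOUT hyperbolic area, from Mathlib's properness of the action of
`SL(2, ℝ)` on `ℍ` (D. Loeffler, `UpperHalfPlane.instProperSMul`):

* `HolRS.finiteIndex_subgroupOf_normalizer_of_compactSpace` — **for `Γ̄ ≤ PSL₂(ℝ)` NON-ABELIAN, acting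
  properly discontinuously on `ℍ` with COMPACT quotient `ℍ/Γ̄`, the subgroup `Γ̄` has finite index in its
  normaliser `N_{PSL₂(ℝ)}(Γ̄)`.**

Route (classical, e.g. S. Katok, *Fuchsian groups*, Thm. 2.3.8 / Cor. of §2.2, without the limit set):
(a) the preimage `Γ̃ ≤ SL(2, ℝ)` of `Γ̄` is DISCRETE (proper discontinuity: only finitely many `γ` move `i`
into a compact neighbourhood of `i`); (b) the preimage `Ñ` of the normaliser is DISCRETE: an element of
`Ñ` close to `1` conjugates two fixed non-commuting `γ̃₁, γ̃₂ ∈ Γ̃` into the isolating neighbourhoods of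
`γ̃₁, γ̃₂` inside `Γ̃`, hence commutes with both, hence is `±1` (two `2 × 2` matrices commuting with a
non-scalar matrix commute — abc-iut-L4-t14's `Matrix.two_mul_comm_of_comm_of_not_scalar`); (c) a
discrete subgroup of `SL(2, ℝ)` is closed and the action of `SL(2, ℝ)` on `ℍ` is PROPER (Mathlib), so for
a compact `K ⊆ ℍ` only finitely many `n ∈ Ñ` have `nK ∩ K ≠ ∅`; (d) `ℍ/Γ̄` compact gives a compact
`K ⊆ ℍ` with `Γ̄·K = ℍ` (local compactness of `ℍ`, openness of the orbit map); (e) every coset of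
`Γ̄` in `N(Γ̄)` meets that finite set, so `[N(Γ̄) : Γ̄] < ∞`.

What is NOT here: the non-compact finite-area case (cusps; the IUT curves are punctured), which needs a
`Γ̄`-invariant compact core; freeness of the action is NOT needed.  Classical; MODEL side of [AbsTopIII]
§4 only; nothing here bears on [IUTchIII] Cor. 3.12; model ≠ reconstruction.
-/

noncomputable section

open scoped UpperHalfPlane MatrixGroups Pointwise Topology
open _root_.MulAction

namespace Literature.AnabelianGeometry.AbsoluteAnabelian

namespace HolRS

/-! ### Generalities: a finite open neighbourhood of `1` makes a subgroup discrete -/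

/-- A topological group with a FINITE open set containing `1` is discrete (in a `T₁` group the finitely
many other points of the set can be removed). [folklore] -/
private theorem discreteTopology_of_finite_open {G : Type*} [Group G] [TopologicalSpace G]
    [IsTopologicalGroup G] [T1Space G] (U : Set G) (hU : IsOpen U) (h1 : (1 : G) ∈ U)
    (hfin : U.Finite) : DiscreteTopology G := by
  apply discreteTopology_of_isOpen_singleton_one
  have hsub : U \ {1} ⊆ U := fun x hx => hx.1
  have hF : IsClosed (U \ {1}) := (hfin.subset hsub).isClosed
  have : ({1} : Set G) = U ∩ (U \ {1})ᶜ := by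
    ext g
    constructor
    · rintro rfl; exact ⟨h1, fun h => h.2 rfl⟩
    · rintro ⟨hg, h⟩
      by_contra hne
      exact h ⟨hg, hne⟩
  rw [this]
  exact hU.inter hF.isOpen_compl

/-! ### The lifts `Γ̃ ⊇ {±1}` and `Ñ` to `SL(2, ℝ)` -/

/-- The fibres of `SL(2, ℝ) → PSL₂(ℝ)` are finite (`{±g}`). [cite: FarkasKra1992, IV.5.6] -/
private theorem finite_fiber_pslMk (q : PSL2R) :
    ((QuotientGroup.mk' (Subgroup.center SL(2, ℝ))) ⁻¹' {q} : Set SL(2, ℝ)).Finite := by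
  obtain ⟨g, rfl⟩ := QuotientGroup.mk_surjective q
  have hsub : ((QuotientGroup.mk' (Subgroup.center SL(2, ℝ))) ⁻¹' {(QuotientGroup.mk g : PSL2R)} :
      Set SL(2, ℝ)) ⊆ {g, -g} := by
    intro x hx
    have hx' : (QuotientGroup.mk x : PSL2R) = QuotientGroup.mk g := hx
    rw [QuotientGroup.eq] at hx'
    rcases mem_center_sl_iff.mp hx' with h | h
    · left
      exact inv_mul_eq_one.mp h
    · right
      have : g = -x := by
        have := congrArg (fun t => x * t) h
        simpa using this
      rw [Set.mem_singleton_iff, this, neg_neg]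
  exact (Set.toFinite _).subset hsub

variable (Γ : Subgroup PSL2R)

/-- **The preimage `Γ̃ ≤ SL(2, ℝ)` of a properly discontinuous `Γ̄ ≤ PSL₂(ℝ)` is DISCRETE**: only
finitely many `γ̃` move `i` into a fixed compact neighbourhood of `i` (proper discontinuity of `Γ̄`
and finiteness of the fibres `{±γ̃}`), and these form a neighbourhood of `1` in `Γ̃`.
[cite: MochizukiAbsTopIII2015, Proposition 4.2 (i) proof p.106] -/
theorem discreteTopology_comap_psl [ProperlyDiscontinuousSMul Γ ℍ] :
    DiscreteTopology (Γ.comap (QuotientGroup.mk' (Subgroup.center SL(2, ℝ)))) := by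
  -- a compact neighbourhood `K` of `i`
  obtain ⟨K, hKc, hKn⟩ := exists_compact_mem_nhds (UpperHalfPlane.I : ℍ)
  -- `T = {g | g • i ∈ K}` is a neighbourhood of `1` in `SL(2, ℝ)`
  let T : Set SL(2, ℝ) := {g | g • UpperHalfPlane.I ∈ K}
  have hT : T ∈ 𝓝 (1 : SL(2, ℝ)) := by
    have hc : Continuous fun g : SL(2, ℝ) => g • UpperHalfPlane.I := by fun_prop
    have : (fun g : SL(2, ℝ) => g • UpperHalfPlane.I) ⁻¹' K ∈ 𝓝 (1 : SL(2, ℝ)) :=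
      hc.continuousAt.preimage_mem_nhds (by rwa [one_smul])
    exact this
  -- `Γ̃ ∩ T` is finite
  have hfin : (T ∩ (Γ.comap (QuotientGroup.mk' (Subgroup.center SL(2, ℝ))) : Set SL(2, ℝ))).Finite := by
    have hF : {γ : Γ | ((γ • ·) '' {(UpperHalfPlane.I : ℍ)} ∩ K).Nonempty}.Finite :=
      ProperlyDiscontinuousSMul.finite_disjoint_inter_image isCompact_singleton hKc
    have hF' : ((fun γ : Γ => (γ : PSL2R)) '' {γ : Γ |
        ((γ • ·) '' {(UpperHalfPlane.I : ℍ)} ∩ K).Nonempty}).Finite := hF.image _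
    refine (hF'.preimage' fun q _ => finite_fiber_pslMk q).subset ?_
    rintro g ⟨hgT, hgΓ⟩
    refine ⟨⟨(QuotientGroup.mk' (Subgroup.center SL(2, ℝ))) g, hgΓ⟩, ?_, rfl⟩
    refine ⟨g • UpperHalfPlane.I, ⟨UpperHalfPlane.I, rfl, rfl⟩, hgT⟩
  -- hence `1` has a finite open neighbourhood in `Γ̃`
  let U : Set (Γ.comap (QuotientGroup.mk' (Subgroup.center SL(2, ℝ)))) := Subtype.val ⁻¹' interior T
  refine discreteTopology_of_finite_open U (isOpen_interior.preimage continuous_subtype_val)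
    (mem_interior_iff_mem_nhds.mpr hT) ?_
  refine Set.Finite.of_finite_image (f := Subtype.val) ?_ Subtype.val_injective.injOn
  refine hfin.subset ?_
  rintro _ ⟨x, hx, rfl⟩
  exact ⟨interior_subset hx, x.2⟩

/-- An element of `SL(2, ℝ)` commuting with two NON-COMMUTING elements is `±1` (it is scalar, since two
matrices commuting with a non-scalar one commute — abc-iut-L4-t14's
`Matrix.two_mul_comm_of_comm_of_not_scalar`). [cite: FarkasKra1992, IV.5.6] -/
theorem sl_eq_one_or_neg_one_of_comm_of_comm (n a b : SL(2, ℝ)) (hab : a * b ≠ b * a)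
    (ha : n * a = a * n) (hb : n * b = b * n) : n = 1 ∨ n = -1 := by
  by_cases hs : ((n : Matrix (Fin 2) (Fin 2) ℝ) 0 1 = 0 ∧ (n : Matrix (Fin 2) (Fin 2) ℝ) 1 0 = 0 ∧
      (n : Matrix (Fin 2) (Fin 2) ℝ) 0 0 = (n : Matrix (Fin 2) (Fin 2) ℝ) 1 1)
  · obtain ⟨h01, h10, h00⟩ := hs
    have hdet := n.2
    rw [Matrix.det_fin_two, h01, h10, ← h00] at hdet
    have hsq : (n : Matrix (Fin 2) (Fin 2) ℝ) 0 0 = 1 ∨ (n : Matrix (Fin 2) (Fin 2) ℝ) 0 0 = -1 := by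
      have : ((n : Matrix (Fin 2) (Fin 2) ℝ) 0 0 - 1) * ((n : Matrix (Fin 2) (Fin 2) ℝ) 0 0 + 1) = 0 := by
        nlinarith [hdet]
      rcases mul_eq_zero.mp this with h | h
      · left; linarith
      · right; linarith
    rcases hsq with h | h
    · left
      ext i j
      fin_cases i <;> fin_cases j <;> simp [h01, h10, ← h00, h]
    · right
      ext i j
      fin_cases i <;> fin_cases j <;> simp [h01, h10, ← h00, h]
  · exfalso
    apply hab
    have ha' : (n : Matrix (Fin 2) (Fin 2) ℝ) * a = a * n := by
      have := congrArg (fun t : SL(2, ℝ) => (t : Matrix (Fin 2) (Fin 2) ℝ)) ha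
      simpa using this
    have hb' : (n : Matrix (Fin 2) (Fin 2) ℝ) * b = b * n := by
      have := congrArg (fun t : SL(2, ℝ) => (t : Matrix (Fin 2) (Fin 2) ℝ)) hb
      simpa using this
    have := Matrix.two_mul_comm_of_comm_of_not_scalar hs ha' hb'
    exact Subtype.ext (by simpa using this)

/-- **The preimage `Ñ ≤ SL(2, ℝ)` of the normaliser of a NON-ABELIAN properly discontinuous `Γ̄` is
DISCRETE**: an element of `Ñ` conjugating two non-commuting `γ̃₁, γ̃₂ ∈ Γ̃` into their isolating
neighbourhoods commutes with both, hence is `±1`; that set is an open neighbourhood of `1` in `Ñ`.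
[cite: MochizukiAbsTopIII2015, Proposition 4.2 (i) proof p.106] -/
theorem discreteTopology_comap_psl_normalizer [ProperlyDiscontinuousSMul Γ ℍ]
    (hΓ : ∃ x y : Γ, x * y ≠ y * x) :
    DiscreteTopology
      ((Subgroup.normalizer (Γ : Set PSL2R)).comap (QuotientGroup.mk' (Subgroup.center SL(2, ℝ)))) := by
  set Nt : Subgroup SL(2, ℝ) :=
    (Subgroup.normalizer (Γ : Set PSL2R)).comap (QuotientGroup.mk' (Subgroup.center SL(2, ℝ)))
  set Gt : Subgroup SL(2, ℝ) := Γ.comap (QuotientGroup.mk' (Subgroup.center SL(2, ℝ)))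
  haveI : DiscreteTopology Gt := discreteTopology_comap_psl Γ
  -- two non-commuting elements of `Γ̃`
  obtain ⟨a, b, ha, hb, hab⟩ : ∃ a b : SL(2, ℝ), a ∈ Gt ∧ b ∈ Gt ∧ a * b ≠ b * a := by
    obtain ⟨x, y, hxy⟩ := hΓ
    obtain ⟨a, ha⟩ := QuotientGroup.mk_surjective (x : PSL2R)
    obtain ⟨b, hb⟩ := QuotientGroup.mk_surjective (y : PSL2R)
    refine ⟨a, b, ?_, ?_, fun h => hxy ?_⟩
    · change (QuotientGroup.mk' (Subgroup.center SL(2, ℝ))) a ∈ Γ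
      rw [show (QuotientGroup.mk' (Subgroup.center SL(2, ℝ))) a = (x : PSL2R) from ha]; exact x.2
    · change (QuotientGroup.mk' (Subgroup.center SL(2, ℝ))) b ∈ Γ
      rw [show (QuotientGroup.mk' (Subgroup.center SL(2, ℝ))) b = (y : PSL2R) from hb]; exact y.2
    · apply Subtype.ext
      change (x : PSL2R) * y = y * x
      rw [← ha, ← hb]
      change (QuotientGroup.mk (a * b) : PSL2R) = QuotientGroup.mk (b * a)
      rw [h]
  -- isolating open sets of `a`, `b` in `SL(2, ℝ)` relative to `Γ̃`
  have hiso : ∀ c ∈ Gt, ∃ V : Set SL(2, ℝ), IsOpen V ∧ c ∈ V ∧ ∀ d ∈ Gt, d ∈ V → d = c := by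
    intro c hc
    have h1 : IsOpen ({⟨c, hc⟩} : Set Gt) := isOpen_discrete _
    obtain ⟨V, hV, hVc⟩ := isOpen_induced_iff.mp h1
    refine ⟨V, hV, ?_, fun d hd hdV => ?_⟩
    · have : (⟨c, hc⟩ : Gt) ∈ Subtype.val ⁻¹' V := by rw [hVc]; rfl
      exact this
    · have : (⟨d, hd⟩ : Gt) ∈ Subtype.val ⁻¹' V := hdV
      rw [hVc] at this
      exact congrArg Subtype.val this
  obtain ⟨Va, hVa, haV, hVa'⟩ := hiso a ha
  obtain ⟨Vb, hVb, hbV, hVb'⟩ := hiso b hb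
  -- conjugates of elements of `Γ̃` by elements of `Ñ` stay in `Γ̃`
  have hconj : ∀ n ∈ Nt, ∀ c ∈ Gt, n * c * n⁻¹ ∈ Gt := by
    intro n hn c hc
    change (QuotientGroup.mk' (Subgroup.center SL(2, ℝ))) (n * c * n⁻¹) ∈ Γ
    rw [map_mul, map_mul, map_inv]
    exact (Subgroup.mem_normalizer_iff.mp hn ((QuotientGroup.mk' (Subgroup.center SL(2, ℝ))) c)).mp hc
  -- the open set `U = {n ∈ Ñ | n a n⁻¹ ∈ Va, n b n⁻¹ ∈ Vb}` of `Ñ` is contained in `{±1}`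
  let U : Set Nt := {n | (n : SL(2, ℝ)) * a * (n : SL(2, ℝ))⁻¹ ∈ Va ∧
    (n : SL(2, ℝ)) * b * (n : SL(2, ℝ))⁻¹ ∈ Vb}
  have hUo : IsOpen U := by
    refine (hVa.preimage ?_).inter (hVb.preimage ?_) <;> fun_prop
  have h1U : (1 : Nt) ∈ U := by
    constructor <;> simp [haV, hbV]
  have hUfin : U.Finite := by
    refine Set.Finite.of_finite_image (f := Subtype.val) ?_ Subtype.val_injective.injOn
    refine (Set.toFinite ({1, -1} : Set SL(2, ℝ))).subset ?_
    rintro _ ⟨n, ⟨hna, hnb⟩, rfl⟩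
    have ha' : (n : SL(2, ℝ)) * a * (n : SL(2, ℝ))⁻¹ = a := hVa' _ (hconj n n.2 a ha) hna
    have hb' : (n : SL(2, ℝ)) * b * (n : SL(2, ℝ))⁻¹ = b := hVb' _ (hconj n n.2 b hb) hnb
    have ha'' : (n : SL(2, ℝ)) * a = a * n := by
      calc (n : SL(2, ℝ)) * a = (n : SL(2, ℝ)) * a * (n : SL(2, ℝ))⁻¹ * n := by group
        _ = a * n := by rw [ha']
    have hb'' : (n : SL(2, ℝ)) * b = b * n := by
      calc (n : SL(2, ℝ)) * b = (n : SL(2, ℝ)) * b * (n : SL(2, ℝ))⁻¹ * n := by group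
        _ = b * n := by rw [hb']
    rcases sl_eq_one_or_neg_one_of_comm_of_comm n a b hab ha'' hb'' with h | h
    · exact Or.inl h
    · exact Or.inr h
  exact discreteTopology_of_finite_open U hUo h1U hUfin

/-- **A compact `K ⊆ ℍ` with `Γ̄ · K = ℍ`** when `ℍ/Γ̄` is compact (finitely many images of relatively
compact open sets cover the compact orbit space; the orbit map is open).
[cite: MochizukiAbsTopIII2015, Proposition 4.2 (i) proof p.106] -/
theorem exists_isCompact_forall_exists_smul_mem [CompactSpace (orbitRel.Quotient Γ ℍ)] :
    ∃ K : Set ℍ, IsCompact K ∧ ∀ τ : ℍ, ∃ γ : Γ, γ • τ ∈ K := by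
  classical
  letI := MulAction.orbitRel Γ ℍ
  -- compact neighbourhoods
  have hnb : ∀ τ : ℍ, ∃ K : Set ℍ, IsCompact K ∧ K ∈ 𝓝 τ := fun τ => exists_compact_mem_nhds τ
  choose Kτ hKc hKn using hnb
  let π : ℍ → orbitRel.Quotient Γ ℍ := Quotient.mk'
  have hπo : IsOpenMap π := isOpenMap_quotient_mk'_mul
  -- the open cover of the quotient by the images of the interiors
  let V : ℍ → Set (orbitRel.Quotient Γ ℍ) := fun τ => π '' interior (Kτ τ)
  have hVo : ∀ τ, IsOpen (V τ) := fun τ => hπo _ isOpen_interior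
  have hcov : (Set.univ : Set (orbitRel.Quotient Γ ℍ)) ⊆ ⋃ τ, V τ := by
    intro q _
    obtain ⟨τ, rfl⟩ := Quotient.mk'_surjective q
    exact Set.mem_iUnion.mpr ⟨τ, τ, mem_interior_iff_mem_nhds.mpr (hKn τ), rfl⟩
  obtain ⟨s, hs⟩ := isCompact_univ.elim_finite_subcover V hVo hcov
  refine ⟨⋃ τ ∈ s, Kτ τ, s.isCompact_biUnion fun τ _ => hKc τ, fun τ => ?_⟩
  have hq : π τ ∈ ⋃ τ' ∈ s, V τ' := hs (Set.mem_univ _)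
  obtain ⟨τ', hτ's, hτ'⟩ := Set.mem_iUnion₂.mp hq
  obtain ⟨σ, hσ, hσπ⟩ := hτ'
  -- `π σ = π τ`: `σ = γ • τ`
  have hrel : σ ∈ MulAction.orbit Γ τ := Quotient.exact' hσπ
  obtain ⟨γ, hγ⟩ := hrel
  refine ⟨γ, Set.mem_iUnion₂.mpr ⟨τ', hτ's, ?_⟩⟩
  have : γ • τ = σ := hγ
  rw [this]
  exact interior_subset hσ

/-- **Cocompactness passes to finite-index subgroups**: if `ℍ/Γ̄` is compact and `Λ̄ ∩ Γ̄` has finite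
index in `Γ̄` (e.g. `Λ̄ ≤ Γ̄` of finite index), then `ℍ/Λ̄` is compact (`Λ̄ · ⋃ᵢ gᵢ⁻¹K = ℍ` for
left-coset representatives `gᵢ`).  With
`finiteIndex_subgroupOf_normalizer_of_compactSpace` this serves every object `Λ̄` of `Loc(PSL₂(ℝ), Γ̄)`
(abc-iut-L4-t14's hypothesis `hN`). [cite: MochizukiAbsTopIII2015, Proposition 4.2 (i) proof p.106] -/
theorem compactSpace_orbitRelQuotient_of_finiteIndex (Λ : Subgroup PSL2R)
    [(Λ.subgroupOf Γ).FiniteIndex] [CompactSpace (orbitRel.Quotient Γ ℍ)] :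
    CompactSpace (orbitRel.Quotient Λ ℍ) := by
  classical
  letI := MulAction.orbitRel Λ ℍ
  obtain ⟨K, hKc, hK⟩ := exists_isCompact_forall_exists_smul_mem Γ
  -- left-coset representatives of `Λ̄` in `Γ̄`
  haveI : Finite (Γ ⧸ Λ.subgroupOf Γ) := Subgroup.finite_quotient_of_finiteIndex
  let rep : Γ ⧸ Λ.subgroupOf Γ → Γ := fun q => Quotient.out q
  let K' : Set ℍ := ⋃ q : Γ ⧸ Λ.subgroupOf Γ, ((rep q : PSL2R)⁻¹ • K)
  have hK'c : IsCompact K' := isCompact_iUnion fun q => (hKc.smul _)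
  -- `Λ̄ · K' = ℍ`
  have hK' : ∀ τ : ℍ, ∃ l : Λ, l • τ ∈ K' := by
    intro τ
    obtain ⟨γ, hγ⟩ := hK τ
    let q : Γ ⧸ Λ.subgroupOf Γ := QuotientGroup.mk γ
    have hq : (QuotientGroup.mk (rep q) : Γ ⧸ Λ.subgroupOf Γ) = QuotientGroup.mk γ := Quotient.out_eq _
    rw [QuotientGroup.eq, Subgroup.mem_subgroupOf] at hq
    -- `l := (rep q)⁻¹ * γ ∈ Λ̄` and `l • τ = (rep q)⁻¹ • γ • τ ∈ (rep q)⁻¹ • K`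
    refine ⟨⟨((rep q : Γ) : PSL2R)⁻¹ * (γ : PSL2R), hq⟩, Set.mem_iUnion.mpr ⟨q, ?_⟩⟩
    change (((rep q : Γ) : PSL2R)⁻¹ * (γ : PSL2R)) • τ ∈ ((rep q : Γ) : PSL2R)⁻¹ • K
    rw [mul_smul]
    exact Set.smul_mem_smul_set hγ
  -- the quotient is the continuous image of the compact `K'`
  refine ⟨?_⟩
  have himg : (Quotient.mk' '' K' : Set (orbitRel.Quotient Λ ℍ)) = Set.univ := by
    refine Set.eq_univ_of_forall fun x => ?_
    obtain ⟨τ, rfl⟩ := Quotient.mk'_surjective x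
    obtain ⟨l, hl⟩ := hK' τ
    refine ⟨l • τ, hl, ?_⟩
    exact Quotient.sound' ⟨l, rfl⟩
  rw [← himg]
  exact hK'c.image continuous_quotient_mk'

/-- **J2 (i) for cocompact groups: `[N_{PSL₂(ℝ)}(Γ̄) : Γ̄] < ∞`.**  Let `Γ̄ ≤ PSL₂(ℝ)` be non-abelian,
acting properly discontinuously on `ℍ` with COMPACT quotient `ℍ/Γ̄`.  Then `Γ̄` has finite index in its
normaliser — i.e. `Aut(ℍ/Γ̄) = N(Γ̄)/Γ̄` is finite; the hypothesis `hN` of abc-iut-L4-t14's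
`HolRS.isIdRigid_mapsTo_pslQuotient_of_centralizer` / `…_of_isSlimGroup` at compact hyperbolic `X`.
(Proper action of `SL(2, ℝ)` on `ℍ` — Mathlib — makes `{n ∈ Ñ | nK ∩ K ≠ ∅}` finite for the discrete
closed `Ñ`; every coset of `Γ̄` in `N(Γ̄)` meets its image.)
[cite: MochizukiAbsTopIII2015, Proposition 4.2 (i) proof p.106] -/
theorem finiteIndex_subgroupOf_normalizer_of_compactSpace [ProperlyDiscontinuousSMul Γ ℍ]
    (hΓ : ∃ x y : Γ, x * y ≠ y * x) [CompactSpace (orbitRel.Quotient Γ ℍ)] :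
    (Γ.subgroupOf (Subgroup.normalizer (Γ : Set PSL2R))).FiniteIndex := by
  classical
  set N : Subgroup PSL2R := Subgroup.normalizer (Γ : Set PSL2R) with hNdef
  let π : SL(2, ℝ) →* PSL2R := QuotientGroup.mk' (Subgroup.center SL(2, ℝ))
  set Nt : Subgroup SL(2, ℝ) := N.comap π with hNt
  haveI : DiscreteTopology Nt := discreteTopology_comap_psl_normalizer Γ hΓ
  have hNtcl : IsClosed (Nt : Set SL(2, ℝ)) := Subgroup.isClosed_of_discrete
  -- the compact `K` with `Γ̄ K = ℍ` and the finite set `S = {n ∈ Ñ | nK ∩ K ≠ ∅}`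
  obtain ⟨K, hKc, hK⟩ := exists_isCompact_forall_exists_smul_mem Γ
  let T : Set SL(2, ℝ) := {g | (g • K ∩ K).Nonempty}
  have hTc : IsCompact T := ProperSMul.isCompact_setOf_inter_nonempty hKc hKc
  have hSfin : (T ∩ (Nt : Set SL(2, ℝ))).Finite := by
    have h1 : IsCompact (Subtype.val ⁻¹' (T ∩ (Nt : Set SL(2, ℝ))) : Set Nt) :=
      hNtcl.isClosedEmbedding_subtypeVal.isCompact_preimage (hTc.inter_right hNtcl)
    have h2 : (Subtype.val ⁻¹' (T ∩ (Nt : Set SL(2, ℝ))) : Set Nt).Finite := h1.finite_of_discrete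
    exact (h2.image Subtype.val).subset fun x hx => ⟨⟨x, hx.2⟩, hx, rfl⟩
  -- every coset of `Γ̄` in `N` is represented by the image of an element of `S`
  obtain ⟨γ₀, hτ₀⟩ := hK UpperHalfPlane.I
  set τ₀ : ℍ := γ₀ • UpperHalfPlane.I with hτ₀def
  have hrep : ∀ n : N, ∃ s : SL(2, ℝ), s ∈ T ∩ (Nt : Set SL(2, ℝ)) ∧
      ∃ hs : π s ∈ N, (QuotientGroup.mk n : N ⧸ Γ.subgroupOf N) = QuotientGroup.mk ⟨π s, hs⟩ := by
    intro n
    obtain ⟨nt, hnt⟩ := QuotientGroup.mk_surjective (n : PSL2R)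
    have hntN : nt ∈ Nt := by change π nt ∈ N; rw [show π nt = (n : PSL2R) from hnt]; exact n.2
    obtain ⟨γ, hγ⟩ := hK (nt • τ₀)
    obtain ⟨gt, hgt⟩ := QuotientGroup.mk_surjective (γ : PSL2R)
    have hgtN : gt ∈ Nt := by
      change π gt ∈ N
      rw [show π gt = (γ : PSL2R) from hgt]
      exact Subgroup.le_normalizer γ.2
    refine ⟨gt * nt, ⟨?_, Nt.mul_mem hgtN hntN⟩, (Nt.mul_mem hgtN hntN : π (gt * nt) ∈ N), ?_⟩
    · -- `(gt * nt) • τ₀ = γ • nt • τ₀ ∈ K` and `τ₀ ∈ K`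
      refine ⟨(gt * nt) • τ₀, ⟨τ₀, hτ₀, rfl⟩, ?_⟩
      have : (gt * nt) • τ₀ = γ • nt • τ₀ := by
        rw [mul_smul]
        change gt • nt • τ₀ = (γ : PSL2R) • nt • τ₀
        rw [← hgt]
        rfl
      rw [this]; exact hγ
    · -- `n⁻¹ · (γ n) = n⁻¹ γ n ∈ Γ̄`
      rw [QuotientGroup.eq, Subgroup.mem_subgroupOf]
      change ((n : PSL2R))⁻¹ * π (gt * nt) ∈ Γ
      rw [map_mul, show π gt = (γ : PSL2R) from hgt, show π nt = (n : PSL2R) from hnt, ← mul_assoc]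
      exact (Subgroup.mem_normalizer_iff''.mp n.2 (γ : PSL2R)).mp γ.2
  -- hence the quotient is finite
  haveI : Finite (N ⧸ Γ.subgroupOf N) := by
    let f : (T ∩ (Nt : Set SL(2, ℝ)) : Set SL(2, ℝ)) → N ⧸ Γ.subgroupOf N :=
      fun s => QuotientGroup.mk ⟨π s.1, s.2.2⟩
    haveI : Finite (T ∩ (Nt : Set SL(2, ℝ)) : Set SL(2, ℝ)) := hSfin.to_subtype
    refine Finite.of_surjective f fun q => ?_
    obtain ⟨n, rfl⟩ := QuotientGroup.mk_surjective q
    obtain ⟨s, hsT, hsN, hq⟩ := hrep n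
    exact ⟨⟨s, hsT⟩, hq.symm⟩
  exact Subgroup.finiteIndex_of_finite_quotient

end HolRS

end Literature.AnabelianGeometry.AbsoluteAnabelian

end
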